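import Summits.BirchSwinnertonDyer.BirchSwinnertonDyer.Theorems.ByReductionTypeAtTwoAdditiveKatoFineConjAReducibleKernel
import Summits.BirchSwinnertonDyer.BirchSwinnertonDyer.Theorems.ByReductionTypeAtTwoAdditiveReducibleKatoMemberSharpOfConjARed
import HarnessLib

/-!
# Route `ByReductionTypeAtTwo` (K4), child C2″ `AdditivePotGoodReducibleRestAtTwo` (item stmt-BirchSwinnertonDyer-22616):
# C2″ VERBATIM FROM FOUR PRINT FACTS AND ONE READING — Lim 2017 Thm. 3.5 at `2` and Ferrero–Washington are IDLE on the
# `E[2]`-reducible additive branch (a `--supports 22616` file; seat `bsd-2adic-k4-w2` GEN 9; sequel of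
# `…AdditiveKatoFineConjAReducibleKernel.lean` + `…AdditiveReducibleKatoMemberSharpOfConjARed.lean`)

HONEST FRAMING (cell `bsd-2adic`, D-0036/D-0054): THEOREMS ONLY (no definition, no named fact, no `sorry`); every theorem is
CONDITIONAL on the named facts it displays — PRINT: modularity (`hmod` newform / `hrat` entire `L`-function), Cassels' isogeny
invariance (`hCassels`), Gross–Zagier–Kolyvagin (`hGZK`); READING: the SHARP member package `hin` =
`Kato2004.exists_memberHullInputs_two_sharp_of_noSplitTwistNegOneNegTwo` = item 23905 `AddRedSharpCountReadingAtTwo` (D-audit hMH2♯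
PASS, AS-PRINTED/EXACT). Closes nothing at the `∀`-level (C2″ stays conditional on these five inputs); BSD is not proved by any of this.

WHAT CHANGES. k4-w2 GEN 4 reached C2″ VERBATIM from SEVEN binders `{hmod, hrat, hin, hLim2, hFW, hCassels, hGZK}`
(`additivePotGoodReducibleRestAtTwo_of_sharpMember'`, p674829) and the closed glue 23906 consumed six heads of C5‴ incl. `hLim2`,
`hFW`. The pair (Lim 2017 Thm. 3.5 at `2` DOWNSTAIRS, Ferrero–Washington) served ONE purpose: statement (A) at `(W', 2)` for Kato's
member `W'`, whose `W'[2]` is reducible. The companion `…AdditiveKatoFineConjAReducibleKernel.lean` PROVES that statement outright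
(`conjA_two_of_not_hasIrreducibleModPGaloisRep_two`: a `Γ_ℚ`-fixed `2`-torsion point makes w2's carrier `ℚ(√−1)`, whose every
`ℤ₂`-extension has `μ = 0` by Iwasawa 1956; w2's KERNEL door p718233), and `…SharpOfConjARed.lean` re-keyed GEN 4's road on that
statement as a displayed hypothesis `hA`. This file plugs the one into the other:

* `conjA_two_of_dvd_torsionOrder_two'` — (A)₂ from `2 ∣ #W(ℚ)_tors`, any model (the companion's version minus the minimality binder);
* `katoMemberShaBound_two_sharp_NST_kernelA` — Kato's member bound at `2`, exponent `2t`, under (NST′), from `hmod` + `hin` ONLY;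
* `missingUpperBoundAt_two_of_katoMemberSharp_two_NST_kernelA` / `…_two_kernelA` — hU3 = `MissingUpperBoundAt W 2` for every globally
  minimal non-CM (NST′) (resp. potentially good) additive `W` with reducible `W[2]` and `r_an = 0`, from `hmod`, `hrat`, `hin`,
  `hCassels`, `hGZK` ONLY — no torsion certificate, no parity of `ord₂ #Ш_an`, no Cassels–Tate, no Lim@2, no Ferrero–Washington
  (the door the `t ≥ 1` census classes' `BSD₂` rungs use from now on);
* **`additivePotGoodReducibleRestAtTwo_of_sharpMember_kernelA hmod hrat hin hCassels hGZK : C2″`** — the route decl VERBATIM from FIVE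
  inputs; `additivePotGoodReducibleRestAtTwo_of_reading_kernelA` — keyed on the route's support item `AddRedSharpCountReadingAtTwo`;
* `addPotMultNST_reducibleUpper_two_sharp_kernelA`, `addNST_reducibleUpper_two_sharp_kernelA` — the (NST′) potentially multiplicative /
  whole-(NST′) block forms (habitat of C4″'s reducible (NST′) upper half; offered to that lane).

References: [Kato2004Asterisque] Thm. 12.4–12.6, (12.5.1) (pp. 221–222), 13.13 (p. 233), §14.8, §14.14, Prop. 14.16 (2) and its proof
(pp. 238–245); [MazurRubin2004] Thm. 2.3.4; [CoatesSujatha2005] Conj. A, Cor. 3.6; [Cassels1965ArithmeticVIII]; [MilneADT2006] I.7.3;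
[Miller2011LMS] Def. 1.1; [GrossZagier1986]; [Kolyvagin1990]; [BreuilConradDiamondTaylor2001].
-/

set_option autoImplicit false
-- sibling precedent (`…AdditiveReducibleKatoMemberSharpNST.lean`): the directory name repeats the summit name
set_option linter.dupNamespace false

noncomputable section

open scoped Classical

namespace Summit.BirchSwinnertonDyer.BirchSwinnertonDyer.Theorems.AddKatoTwo

open WeierstrassCurve Literature.NumberTheory.EllipticCurves
  Literature.NumberTheory.EllipticCurves.ModularForms
  Literature.NumberTheory.EllipticCurves.Kato2004
  Literature.NumberTheory.EllipticCurves.Rank1Residual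
  Literature.NumberTheory.EllipticCurves.Rank1Residual.Typed
  Literature.NumberTheory.IwasawaTheory
  Summit.BirchSwinnertonDyer.Rank1Residual Summit.BirchSwinnertonDyer.Rank1Residual.Additive

/-! ## (A)₂ from a rational point of order `2`, any model -/

/-- **(A)₂ for every elliptic `W/ℚ` with `2 ∣ #W(ℚ)_tors`, ANY MODEL** (no minimality hypothesis — the companion's
`conjA_two_of_dvd_torsionOrder_two` carries a spurious `IsGloballyMinimal` binder): a rational point of order `2` makes `W[2]` reducible
(`not_hasIrreducibleModPGaloisRep_of_dvd_torsionOrder`), then `conjA_two_of_not_hasIrreducibleModPGaloisRep_two`. KERNEL, no named fact.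
[cite: Mazur1977, Ch. III §5, p. 157] [cite: CoatesSujatha2005, Conj. A and Cor. 3.6] -/
theorem conjA_two_of_dvd_torsionOrder_two' (W : WeierstrassCurve ℚ) [W.IsElliptic] (htors : 2 ∣ W.torsionOrder) :
    ∀ (κ : ZpExtension ℚ 2), κ.IsCyclotomic →
      ∃ (γ : Field.absoluteGaloisGroup ℚ) (D : W.FineSelmerDualData κ γ),
        Module.Finite ℤ_[2] (RestrictScalars ℤ_[2] (IwasawaAlgebra 2) D.X) :=
  haveI : Fact (Nat.Prime 2) := ⟨Nat.prime_two⟩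
  conjA_two_of_not_hasIrreducibleModPGaloisRep_two W (not_hasIrreducibleModPGaloisRep_of_dvd_torsionOrder W 2 htors)

/-! ## The `E[2]`-reducible additive branch WITHOUT Lim 2017@2 and Ferrero–Washington: C2″ from four print facts + one reading -/

/-- **Kato's member bound at `p = 2` for REDUCIBLE `E[2]` under (NST′), SHARP — from modularity and the sharp member reading ONLY**
(the companion's `katoMemberShaBound_two_sharp_NST_of_conjARed` with `hA` := `conjA_two_of_not_hasIrreducibleModPGaloisRep_two`). Conditional on `hmod`, `hin`; no Lim@2, no
Ferrero–Washington. [cite: Kato2004Asterisque, Prop. 14.16 (2) and its proof (pp. 244–245), (12.5.1) (p. 222), 13.13 (p. 233)]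
[cite: MazurRubin2004, Thm. 2.3.4] -/
theorem katoMemberShaBound_two_sharp_NST_kernelA (hmod : exists_isNewformOf)
    (hin : Kato2004.exists_memberHullInputs_two_sharp_of_noSplitTwistNegOneNegTwo)
    (W : WeierstrassCurve ℚ) [W.IsElliptic] [W.IsGloballyMinimal] (hcm : ¬ W.HasCM)
    (hng : ¬ W.HasGoodReductionAtPrime 2) (hnm : ¬ W.HasMultiplicativeReductionAtPrime 2)
    (hnst : ∀ d : ℚ, d = -1 ∨ d = -2 → ¬ (W.quadraticTwist d).HasSplitMultiplicativeReductionAtPrime 2)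
    (hred : ¬ W.HasIrreducibleModPGaloisRep 2)
    (hL : W.entireLFunction 1 ≠ 0) (hfin : Finite W.sha) :
    ∃ (W' : WeierstrassCurve ℚ) (_ : W'.IsElliptic) (_ : W'.IsGloballyMinimal),
      IsIsogenous W W' ∧ Finite W'.sha ∧
      ∃ q : ℚ, W'.entireLFunction 1 / (W'.realPeriodRat : ℂ) = (q : ℂ) ∧
        (padicValNat 2 (Nat.card (AddCommGroup.primaryComponent W'.sha 2)) : ℤ) +
            padicValNat 2 W'.tamagawaProduct ≤
          padicValRat 2 q + 2 * (padicValNat 2 W'.torsionOrder : ℤ) :=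
  katoMemberShaBound_two_sharp_NST_of_conjARed hmod hin (fun V _ hV => conjA_two_of_not_hasIrreducibleModPGaloisRep_two V hV)
    W hcm hng hnm hnst hred hL hfin

/-- **hU3 = `MissingUpperBoundAt W 2` for EVERY globally minimal non-CM (NST′) ADDITIVE `W` with reducible `W[2]` and `r_an = 0`,
from `hmod`, `hrat`, `hin`, `hCassels`, `hGZK` ONLY** — no torsion/parity side condition, no Lim@2, no Ferrero–Washington (the
companion's `…_NST_of_conjARed` with `hA` := the kernel (A)₂). [cite: Kato2004Asterisque, Prop. 14.16 (2) (p. 244), (12.5.1) (p. 222)]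
[cite: Cassels1965ArithmeticVIII] [cite: Miller2011LMS, Def. 1.1] -/
theorem missingUpperBoundAt_two_of_katoMemberSharp_two_NST_kernelA (hmod : exists_isNewformOf)
    (hin : Kato2004.exists_memberHullInputs_two_sharp_of_noSplitTwistNegOneNegTwo)
    (hCassels : bsdRHS_eq_of_isIsogenous)
    (hGZK : rank_eq_analyticRank_of_analyticRank_le_one) (hrat : hasEntireLFunction_rat)
    (W : WeierstrassCurve ℚ) [W.IsElliptic] [W.IsGloballyMinimal] (hcm : ¬ W.HasCM)
    (hng : ¬ W.HasGoodReductionAtPrime 2) (hnm : ¬ W.HasMultiplicativeReductionAtPrime 2)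
    (hnst : ∀ d : ℚ, d = -1 ∨ d = -2 → ¬ (W.quadraticTwist d).HasSplitMultiplicativeReductionAtPrime 2)
    (hred : ¬ W.HasIrreducibleModPGaloisRep 2) (hr : W.analyticRank = 0) :
    MissingUpperBoundAt W 2 :=
  missingUpperBoundAt_two_of_katoMemberSharp_two_NST_of_conjARed hmod hin
    (fun V _ hV => conjA_two_of_not_hasIrreducibleModPGaloisRep_two V hV) hCassels hGZK hrat W hcm hng hnm hnst hred hr

/-- **hU3 on the POTENTIALLY GOOD reducible additive rank-`0` non-CM curves, from `hmod`, `hrat`, `hin`, `hCassels`, `hGZK` ONLY**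
(`0 ≤ ord₂ j` ⟹ (NST′)). The door the per-class `BSD₂` rungs of the `t ≥ 1` census classes now use: compared with addL2x's
`missingUpperBoundAt_two_of_katoMember_two_of_torsionCertificate` it needs NO Lim@2, NO Ferrero–Washington, NO Cassels–Tate, NO
torsion certificate and NO parity of `ord₂ #Ш_an` (the sharp count, k4-w2 GEN 4). [cite: Kato2004Asterisque, Prop. 14.16 (2) (p. 244)]
[cite: Cassels1965ArithmeticVIII] [cite: Miller2011LMS, Def. 1.1] -/
theorem missingUpperBoundAt_two_of_katoMemberSharp_two_kernelA (hmod : exists_isNewformOf)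
    (hin : Kato2004.exists_memberHullInputs_two_sharp_of_noSplitTwistNegOneNegTwo)
    (hCassels : bsdRHS_eq_of_isIsogenous)
    (hGZK : rank_eq_analyticRank_of_analyticRank_le_one) (hrat : hasEntireLFunction_rat)
    (W : WeierstrassCurve ℚ) [W.IsElliptic] [W.IsGloballyMinimal] (hcm : ¬ W.HasCM)
    (hng : ¬ W.HasGoodReductionAtPrime 2) (hnm : ¬ W.HasMultiplicativeReductionAtPrime 2)
    (hj : 0 ≤ padicValRat 2 W.j) (hred : ¬ W.HasIrreducibleModPGaloisRep 2) (hr : W.analyticRank = 0) :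
    MissingUpperBoundAt W 2 :=
  missingUpperBoundAt_two_of_katoMemberSharp_two_of_conjARed hmod hin
    (fun V _ hV => conjA_two_of_not_hasIrreducibleModPGaloisRep_two V hV) hCassels hGZK hrat W hcm hng hnm hj hred hr

/-- **C2″ `AdditivePotGoodReducibleRestAtTwo` (item stmt-BirchSwinnertonDyer-22616) — the route decl VERBATIM — FROM FOUR PRINT FACTS AND
ONE READING: modularity (`hmod` newform, `hrat` entire `L`-function), the SHARP member reading (`hin` = item 23905), Cassels'
isogeny invariance (`hCassels`), Gross–Zagier–Kolyvagin (`hGZK`).** k4-w2 GEN 4's road (`additivePotGoodReducibleRestAtTwo_of_sharpMember'`: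
SEVEN binders) minus Lim 2017 Thm. 3.5 at `2` and Ferrero–Washington, which served only statement (A) at Kato's member — now the
kernel theorem `conjA_two_of_not_hasIrreducibleModPGaloisRep_two`. The item does NOT close: the five inputs are named facts (PRINT/READING). Nothing else is assumed; the member-sub-block
conjunct of C2″ is not used. [cite: Kato2004Asterisque, Prop. 14.16 (2) and its proof (pp. 244–245)] [cite: Cassels1965ArithmeticVIII]
[cite: GrossZagier1986] [cite: Kolyvagin1990] [cite: BreuilConradDiamondTaylor2001] -/
theorem additivePotGoodReducibleRestAtTwo_of_sharpMember_kernelA (hmod : exists_isNewformOf)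
    (hrat : hasEntireLFunction_rat) (hin : Kato2004.exists_memberHullInputs_two_sharp_of_noSplitTwistNegOneNegTwo)
    (hCassels : bsdRHS_eq_of_isIsogenous) (hGZK : rank_eq_analyticRank_of_analyticRank_le_one) :
    Summit.BirchSwinnertonDyer.BirchSwinnertonDyer.Theses.ByReductionTypeAtTwo.AdditivePotGoodReducibleRestAtTwo :=
  additivePotGoodReducibleRestAtTwo_of_sharpMember_of_conjARed hmod hrat hin
    (fun V _ hV => conjA_two_of_not_hasIrreducibleModPGaloisRep_two V hV) hCassels hGZK

/-- **C2″ from the route's support item 23905 `AddRedSharpCountReadingAtTwo` plus FOUR of the eleven heads of C5‴ `AdditivePrintedInputsAtTwo`**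
(GZK, entire `L`-function, newform, Cassels) — compare the closed glue 23906 `AdditivePotGoodReducibleRestAtTwoOfInputs`, whose
proof consumed six heads incl. Lim@2 and Ferrero–Washington. Bookkeeping corollary. [cite: Kato2004Asterisque, Prop. 14.16 (2) (p. 244)]
[cite: Cassels1965ArithmeticVIII] -/
theorem additivePotGoodReducibleRestAtTwo_of_reading_kernelA
    (hinS : Summit.BirchSwinnertonDyer.BirchSwinnertonDyer.Theses.ByReductionTypeAtTwo.AddRedSharpCountReadingAtTwo)
    (hGZK : rank_eq_analyticRank_of_analyticRank_le_one) (hrat : hasEntireLFunction_rat) (hmod : exists_isNewformOf)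
    (hCassels : bsdRHS_eq_of_isIsogenous) :
    Summit.BirchSwinnertonDyer.BirchSwinnertonDyer.Theses.ByReductionTypeAtTwo.AdditivePotGoodReducibleRestAtTwo :=
  additivePotGoodReducibleRestAtTwo_of_sharpMember_kernelA hmod hrat hinS hCassels hGZK

/-- **hU3 on the `E[2]`-REDUCIBLE potentially MULTIPLICATIVE (NST′) curves, from `hmod`, `hrat`, `hin`, `hCassels`, `hGZK` ONLY**
(`¬CM → r_an = 0 → Addv W 2 → ord₂ j < 0 → (NST′) → ¬ irreducible → MissingUpperBoundAt W 2`; the habitat of C4″'s reducible (NST′)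
upper half — offered to that lane; no Lim@2, no Ferrero–Washington). [cite: Kato2004Asterisque, Prop. 14.16 (2) (p. 244), (12.5.1) (p. 222), 13.13 (p. 233)]
[cite: Cassels1965ArithmeticVIII] -/
theorem addPotMultNST_reducibleUpper_two_sharp_kernelA (hmod : exists_isNewformOf) (hrat : hasEntireLFunction_rat)
    (hin : Kato2004.exists_memberHullInputs_two_sharp_of_noSplitTwistNegOneNegTwo)
    (hCassels : bsdRHS_eq_of_isIsogenous) (hGZK : rank_eq_analyticRank_of_analyticRank_le_one) :
    ∀ (W : WeierstrassCurve ℚ) [W.IsElliptic] [W.IsGloballyMinimal], ¬ W.HasCM → W.analyticRank = 0 →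
      Addv W 2 → padicValRat 2 W.j < 0 →
      (∀ d : ℚ, d = -1 ∨ d = -2 → ¬ (W.quadraticTwist d).HasSplitMultiplicativeReductionAtPrime 2) →
      ¬ W.HasIrreducibleModPGaloisRep 2 → MissingUpperBoundAt W 2 :=
  addPotMultNST_reducibleUpper_two_sharp_of_conjARed hmod hrat hin
    (fun V _ hV => conjA_two_of_not_hasIrreducibleModPGaloisRep_two V hV) hCassels hGZK

/-- **The whole (NST′) ADDITIVE reducible block at once, from `hmod`, `hrat`, `hin`, `hCassels`, `hGZK` ONLY**
(`¬CM → r_an = 0 → Addv W 2 → (NST′) → ¬ irreducible → MissingUpperBoundAt W 2`). [cite: Kato2004Asterisque, Prop. 14.16 (2) (p. 244)]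
[cite: Cassels1965ArithmeticVIII] -/
theorem addNST_reducibleUpper_two_sharp_kernelA (hmod : exists_isNewformOf) (hrat : hasEntireLFunction_rat)
    (hin : Kato2004.exists_memberHullInputs_two_sharp_of_noSplitTwistNegOneNegTwo)
    (hCassels : bsdRHS_eq_of_isIsogenous) (hGZK : rank_eq_analyticRank_of_analyticRank_le_one) :
    ∀ (W : WeierstrassCurve ℚ) [W.IsElliptic] [W.IsGloballyMinimal], ¬ W.HasCM → W.analyticRank = 0 →
      Addv W 2 → (∀ d : ℚ, d = -1 ∨ d = -2 → ¬ (W.quadraticTwist d).HasSplitMultiplicativeReductionAtPrime 2) →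
      ¬ W.HasIrreducibleModPGaloisRep 2 → MissingUpperBoundAt W 2 :=
  addNST_reducibleUpper_two_sharp_of_conjARed hmod hrat hin
    (fun V _ hV => conjA_two_of_not_hasIrreducibleModPGaloisRep_two V hV) hCassels hGZK

end Summit.BirchSwinnertonDyer.BirchSwinnertonDyer.Theorems.AddKatoTwo

end
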